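import Summits.KontsevichZagierPeriods.KontsevichZagierPeriods.Theorems.RootDecompWalshStrataPlanarSections01

/-!
# Planar sections, part 2/2: Newton–Leibniz over the cells of a cylindrical decomposition (the engine)

Declarations `InBaker.of_cadCell` (one cell: bands, rule (3), cancellation of interior sections) and
`InBaker.of_planar_sections` (the engine) of the farm-checked gen-7 file; see the module docstring of
`RootDecompWalshStrataPlanarSections01` (part 1) for the overview, the mechanism and the sources.
[KontsevichZagier2001 §1.2 rules (1),(3); BasuPollackRoy2006 Cor. 5.7; BCR1998 §2.2]
-/

noncomputable section

open Literature.NumberTheory.Transcendental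
open MeasureTheory Set
open MvPolynomial (aeval X C)
open Literature.ModelTheory.ExponentialFields (IsSemialgebraic isSemialgebraic_univ
  isSemialgebraic_setOf_eval_pos isSemialgebraic_setOf_eval_lt isSemialgebraic_setOf_eval_le
  isSemialgebraic_setOf_eval_nonneg isSemialgebraic_setOf_eval_eq_zero continuous_aeval_real
  tarski_seidenberg_real_holds graphOver bandOver bandLower bandUpper mem_bandOver_iff
  snoc_mem_bandOver_iff snoc_mem_bandOver_iff_of_ne bandLower_of_ne_zero bandUpper_of_ne_last
  bandLower_succ bandUpper_castSucc bandLower_zero bandUpper_last)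
open Literature.ModelTheory.ExponentialFields.CylindricalDecomposition (mem_band_iff band_eq_band
  not_mem_band_of_eq exists_mem_band)

namespace Summit.KontsevichZagierPeriods.RootDecompWalshStrata.ConicDescent

/-- `t ↦ (x, t)` is continuous.  (PRIVATE copy of the part-1 lemma: its landed twin
`…ArrangementNormalForm.JanusBands.IntegrateOut.continuous_snoc` lives outside this chain; gate lint
`dedup.landed`.) -/
private theorem continuous_snoc_right {N : ℕ} (x : Fin N → ℝ) :
    Continuous fun t : ℝ => (Fin.snoc x t : Fin (N + 1) → ℝ) :=
  continuous_pi fun i => by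
    induction i using Fin.lastCases with
    | last => simp only [Fin.snoc_last]; exact continuous_id
    | cast i => simp only [Fin.snoc_castSucc]; exact continuous_const

/-! #### 25.3 One cell of the base: bands, Newton–Leibniz, cancellation of interior sections -/

/-- **NEWTON–LEIBNIZ OVER ONE CELL, MODULO THE BAKER SECTOR.**  `W ⊆ [0,1]^{N+1}` open and
`ℚ`-semialgebraic, `Φ` a continuous `ℚ`-semialgebraic potential with `∂Φ/∂t = r.integrand` on
`r.domain = W ∩ (C × ℝ)`, `C` a `ℚ`-semialgebraic cell carrying continuous `ℚ`-semialgebraic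
increasing sections `ξ` over which the fibres of `W` are the section values `j ∈ G` and the bands
`j ∈ B`.  If every section term `[C, Φ(x, ζ x)]` with graph in `frontier W` is in the Baker sector,
so is `[r]`: null cell ⇒ relation; else all bands of `W` over `C` are inner,
`[r] ≡ Σ_{j ∈ B} [band_j, f] ≡ Σ_{j ∈ B} [C, Φ(·, ξ_j) − Φ(·, ξ_{j−1})]` (rules (1), (3)), and the sum
telescopes to `Σ_{tops ∖ bottoms} [C, Φ(·, ξ_i)] − Σ_{bottoms ∖ tops} [C, Φ(·, ξ_i)]`, whose sections have
graph in `closure W ∖ W` (`fibre_endpoints`, `adjacent_mem_of_snoc_mem`).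
[KontsevichZagier2001 §1.2 rules (1),(3); BasuPollackRoy2006 Cor. 5.7] -/
theorem InBaker.of_cadCell {N l : ℕ} {W : Set (Fin (N + 1) → ℝ)} (hWo : IsOpen W)
    (hWs : IsSemialgebraic ℚ W) (hWI : W ⊆ Icc 0 1) (Φ : (Fin (N + 1) → ℝ) → ℝ)
    (hΦs : IsSemialgebraicFunOn ℚ univ Φ) (hΦc : Continuous Φ)
    {C : Set (Fin N → ℝ)} (hC : IsSemialgebraic ℚ C) (ξ : Fin l → (Fin N → ℝ) → ℝ)
    (hξ : ∀ i, IsSemialgebraicFunOn ℚ C (ξ i)) (hξc : ∀ i, ContinuousOn (ξ i) C)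
    (hmono : ∀ x ∈ C, StrictMono fun i => ξ i x) (G : Finset (Fin l)) (B : Finset (Fin (l + 1)))
    (hBsub : ∀ j ∈ B, bandOver C ξ j ⊆ W) (hBsa : ∀ j, IsSemialgebraic ℚ (bandOver C ξ j))
    (hfib : ∀ x ∈ C, {t : ℝ | (Fin.snoc x t : Fin (N + 1) → ℝ) ∈ W} = (⋃ j ∈ G, {ξ j x}) ∪
      ⋃ j ∈ B, {t : ℝ | bandLower ξ j x < (t : EReal) ∧ (t : EReal) < bandUpper ξ j x})
    (r : KZ.IntegralRep (N + 1)) (hrd : r.domain = W ∩ {z | Fin.init z ∈ C})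
    (hder : ∀ z ∈ r.domain,
      HasDerivAt (fun s : ℝ => Φ (Fin.snoc (Fin.init z) s)) (r.integrand z) (z (Fin.last N)))
    (hsec : ∀ ζ : (Fin N → ℝ) → ℝ, IsSemialgebraicFunOn ℚ C ζ → ContinuousOn ζ C →
      (∀ x ∈ C, (Fin.snoc x (ζ x) : Fin (N + 1) → ℝ) ∈ frontier W) →
      ∀ r₁ : KZ.IntegralRep N, r₁.domain = C →
        EqOn r₁.integrand (fun x => Φ (Fin.snoc x (ζ x))) C → InBaker (KZ.of r₁)) :
    InBaker (KZ.of r) := by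
  classical
  have hWm : MeasurableSet W := hWs.measurableSet_holds
  have hWfin : volume W ≠ ⊤ := ((measure_mono hWI).trans_lt isCompact_Icc.measure_lt_top).ne
  have hCm : MeasurableSet C := hC.measurableSet_holds
  have hclI : closure W ⊆ Icc (0 : Fin (N + 1) → ℝ) 1 := closure_minimal hWI isClosed_Icc
  by_cases hC0 : volume C = 0
  · exact InBaker.of_mem_relations (KZ.of_mem_relations_of_volume_eq_zero r (by
      rw [hrd]
      exact measure_mono_null inter_subset_right (KZ.volume_setOf_init_mem_eq_zero (n := N) hC0)))
  -- all bands of `W` over `C` are inner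
  have hinner : ∀ j ∈ B, j ≠ 0 ∧ j ≠ Fin.last l := fun j hj =>
    KZ.ne_zero_and_ne_last_of_bandOver_subset hWm hWfin hCm hC0 ξ (hBsub j hj)
  have h0 : ∀ j : {j // j ∈ B}, (j : Fin (l + 1)) ≠ 0 := fun j => (hinner j j.2).1
  have hl : ∀ j : {j // j ∈ B}, (j : Fin (l + 1)) ≠ Fin.last l := fun j => (hinner j j.2).2
  -- a bound for the potential on the closed unit cube
  obtain ⟨M, hM⟩ : ∃ M : ℝ, ∀ z ∈ (Icc 0 1 : Set (Fin (N + 1) → ℝ)), |Φ z| ≤ M := by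
    obtain ⟨M, hM⟩ := isCompact_Icc.exists_bound_of_continuousOn hΦc.continuousOn
    exact ⟨M, fun z hz => by simpa only [Real.norm_eq_abs] using hM z hz⟩
  -- sections as semialgebraic integrands over `C`
  have hsecsa : ∀ ζ : (Fin N → ℝ) → ℝ, IsSemialgebraicFunOn ℚ C ζ →
      IsSemialgebraicFunOn ℚ C (fun x => Φ (Fin.snoc x (ζ x) : Fin (N + 1) → ℝ)) :=
    fun ζ hζ => isSemialgebraicFunOn_comp_snoc hC hΦs hζ
  -- the edges of the inner bands
  set lo : {j // j ∈ B} → (Fin N → ℝ) → ℝ := fun j => ξ ((j : Fin (l + 1)).pred (h0 j)) with hlodef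
  set hi : {j // j ∈ B} → (Fin N → ℝ) → ℝ := fun j => ξ ((j : Fin (l + 1)).castPred (hl j))
    with hhidef
  have hlosa : ∀ j, IsSemialgebraicFunOn ℚ C (lo j) := fun j => hξ _
  have hhisa : ∀ j, IsSemialgebraicFunOn ℚ C (hi j) := fun j => hξ _
  have hfibre : ∀ (j : {j // j ∈ B}) (x : Fin N → ℝ) (t : ℝ),
      (Fin.snoc x t : Fin (N + 1) → ℝ) ∈ bandOver C ξ j ↔ x ∈ C ∧ t ∈ Ioo (lo j x) (hi j x) :=
    fun j x t => snoc_mem_bandOver_iff_of_ne (h0 j) (hl j)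
  have hmemband : ∀ (j : {j // j ∈ B}) (z : Fin (N + 1) → ℝ),
      z ∈ bandOver C ξ j ↔ Fin.init z ∈ C ∧ z (Fin.last N) ∈ Ioo (lo j (Fin.init z)) (hi j (Fin.init z)) := by
    intro j z
    rw [← hfibre j (Fin.init z) (z (Fin.last N)), Fin.snoc_init_self]
  have hlohi : ∀ j, ∀ x ∈ C, lo j x < hi j x := fun j x hx =>
    hmono x hx (Fin.pred_lt_castPred (h0 j) (hl j))
  have hIooW : ∀ j, ∀ x ∈ C, ∀ t ∈ Ioo (lo j x) (hi j x), (Fin.snoc x t : Fin (N + 1) → ℝ) ∈ W :=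
    fun j x hx t ht => hBsub j j.2 ((hfibre j x t).2 ⟨hx, ht⟩)
  have hends : ∀ j, ∀ x ∈ C, x ∈ Icc (0 : Fin N → ℝ) 1 ∧
      (Fin.snoc x (lo j x) : Fin (N + 1) → ℝ) ∈ closure W ∧
      (Fin.snoc x (hi j x) : Fin (N + 1) → ℝ) ∈ closure W :=
    fun j x hx => fibre_endpoints hWI (hlohi j x hx) (hIooW j x hx)
  have hCb : ∀ j : {j // j ∈ B}, Bornology.IsBounded C := fun j =>
    (Metric.isBounded_Icc (0 : Fin N → ℝ) 1).subset fun x hx => (hends j x hx).1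
  -- Step 1: cut `[r]` into its open bands (rule (1a); the graphs are null)
  have hObsub : ∀ j : {j // j ∈ B}, bandOver C ξ j ⊆ r.domain := fun j z hz => by
    rw [hrd]; exact ⟨hBsub j j.2 hz, (mem_bandOver_iff.1 hz).1⟩
  set Ob : {j // j ∈ B} → KZ.IntegralRep (N + 1) := fun j =>
    r.restrict (bandOver C ξ j) (hBsa j) (hObsub j) with hObdef
  have hObd : ∀ j, (Ob j).domain = bandOver C ξ j := fun j => rfl
  have hObi : ∀ j, (Ob j).integrand = r.integrand := fun j => rfl
  have e1 : KZ.of r - ∑ j ∈ B.attach, KZ.of (Ob j) ∈ KZ.relations := by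
    refine KZ.of_sub_sum_of_mem_relations B.attach r Ob (fun j _ => ?_) (fun j _ x _ => by rw [hObi])
      ?_ ?_
    · rw [hObd, show bandOver C ξ j \ r.domain = ∅ from sdiff_eq_empty.mpr (hObsub j), measure_empty]
    · have hsub : r.domain \ ⋃ j ∈ B.attach, (Ob j).domain ⊆
          ⋃ j ∈ G, {z : Fin (N + 1) → ℝ | Fin.init z ∈ C ∧ z (Fin.last N) = ξ j (Fin.init z)} := by
        intro z hz
        rw [hrd] at hz
        obtain ⟨⟨hzW, hzC⟩, hzU⟩ := hz
        have hzC : Fin.init z ∈ C := hzC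
        have ht : z (Fin.last N) ∈ {t : ℝ | (Fin.snoc (Fin.init z) t : Fin (N + 1) → ℝ) ∈ W} := by
          show Fin.snoc (Fin.init z) (z (Fin.last N)) ∈ W
          rw [Fin.snoc_init_self]; exact hzW
        rw [hfib _ hzC] at ht
        rcases ht with ht | ht
        · simp only [mem_iUnion, mem_singleton_iff, exists_prop] at ht
          obtain ⟨j, hj, hjt⟩ := ht
          exact mem_iUnion₂.2 ⟨j, hj, hzC, hjt⟩
        · simp only [mem_iUnion, mem_setOf_eq, exists_prop] at ht
          obtain ⟨j, hj, hjt⟩ := ht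
          exact absurd (mem_iUnion₂.2 ⟨⟨j, hj⟩, Finset.mem_attach _ _, by
            rw [hObd]; exact mem_bandOver_iff.2 ⟨hzC, hjt.1, hjt.2⟩⟩) hzU
      refine measure_mono_null hsub ((measure_biUnion_null_iff G.countable_toSet).2 fun j _ => ?_)
      exact KZ.volume_graph_eq_zero (hξ j)
    · intro j _ j' _ hne
      have hne' : (j : Fin (l + 1)) ≠ j' := fun h => hne (Subtype.ext h)
      have : (Ob j).domain ∩ (Ob j').domain = ∅ := by
        rw [hObd, hObd]
        ext z
        simp only [mem_inter_iff, mem_empty_iff_false, iff_false, not_and]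
        intro hz hz'
        rw [mem_bandOver_iff] at hz hz'
        exact (Set.disjoint_left.1 (KZ.disjoint_bandFibre ξ (hmono _ hz.1) hne')) ⟨hz.2.1, hz.2.2⟩
          ⟨hz'.2.1, hz'.2.2⟩
      rw [this, measure_empty]
  -- Step 2: close the bands (null modification) and go down by Newton–Leibniz (rule (3))
  set f' : (Fin (N + 1) → ℝ) → ℝ := W.indicator r.integrand with hf'def
  have hf'W : ∀ z ∈ W, f' z = r.integrand z := fun z hz => indicator_of_mem hz _
  have hf'nW : ∀ z ∉ W, f' z = 0 := fun z hz => indicator_of_notMem hz _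
  have hband : ∀ j, IsSemialgebraic ℚ (KZlog.band C (lo j) (hi j)) := fun j =>
    KZlog.isSemialgebraic_band (hlosa j) (hhisa j)
  have hObsubband : ∀ j : {j // j ∈ B}, bandOver C ξ (j : Fin (l + 1)) ⊆ KZlog.band C (lo j) (hi j) :=
      fun j z hz => by
    rw [hmemband] at hz
    exact KZlog.mem_band.2 ⟨hz.1, hz.2.1.le, hz.2.2.le⟩
  have hnull : ∀ j : {j // j ∈ B}, volume (KZlog.band C (lo j) (hi j) \ bandOver C ξ (j : Fin (l + 1))) = 0 := by
    intro j
    refine measure_mono_null (fun z hz => ?_)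
      (measure_union_null (KZ.volume_graph_eq_zero (hlosa j)) (KZ.volume_graph_eq_zero (hhisa j)))
    obtain ⟨hz, hz'⟩ := hz
    rw [KZlog.mem_band] at hz
    obtain ⟨hzC, h1, h2⟩ := hz
    rw [hmemband] at hz'
    rcases h1.lt_or_eq with h1 | h1
    · rcases h2.lt_or_eq with h2 | h2
      · exact absurd ⟨hzC, h1, h2⟩ hz'
      · exact Or.inr ⟨hzC, h2⟩
    · exact Or.inl ⟨hzC, h1.symm⟩
  have hf's : ∀ j, IsSemialgebraicFunOn ℚ (KZlog.band C (lo j) (hi j)) f' := by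
    intro j
    have h1 : IsSemialgebraicFunOn ℚ (KZlog.band C (lo j) (hi j) ∩ W) r.integrand :=
      r.isSemialgebraicFunOn_integrand.mono (fun z hz => by
        rw [hrd]; exact ⟨hz.2, (KZlog.mem_band.1 hz.1).1⟩) ((hband j).inter hWs)
    have h2 : IsSemialgebraicFunOn ℚ (KZlog.band C (lo j) (hi j) \ W) (fun _ => ((0 : ℚ) : ℝ)) :=
      isSemialgebraicFunOn_ratCast ((hband j).diff hWs) 0
    have := h1.union h2 (fun z hz => hf'W z hz.2) (fun z hz => by rw [hf'nW z hz.2, Rat.cast_zero])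
    rwa [inter_union_sdiff] at this
  have hf'i : ∀ j, IntegrableOn f' (KZlog.band C (lo j) (hi j)) volume := by
    intro j
    have h1 : IntegrableOn f' (bandOver C ξ j) volume :=
      ((r.integrableOn.mono_set (hObsub j)).congr_fun (fun z hz => (hf'W z (hBsub j j.2 hz)).symm)
        (hBsa j).measurableSet_holds)
    have h2 : IntegrableOn f' (KZlog.band C (lo j) (hi j) \ bandOver C ξ j) volume := by
      rw [IntegrableOn, Measure.restrict_eq_zero.2 (hnull j)]
      exact integrable_zero_measure
    exact (integrableOn_union.2 ⟨h1, h2⟩).mono_set (by rw [union_sdiff_self]; exact subset_union_right)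
  have hNL : ∀ j : {j // j ∈ B}, ∃ (rb : KZ.IntegralRep (N + 1)) (rd : KZ.IntegralRep N),
      rb.domain = KZlog.band C (lo j) (hi j) ∧ rb.integrand = f' ∧ rd.domain = C ∧
      (rd.integrand = fun x => Φ (Fin.snoc x (hi j x)) - Φ (Fin.snoc x (lo j x))) ∧
      KZ.of rb - KZ.of rd ∈ KZ.relations := by
    intro j
    refine KZ.exists_band_newtonLeibniz hC (lo j) (hi j) (hlosa j) (hhisa j)
      (fun x hx => (hlohi j x hx).le) Φ f' (hΦs.mono (subset_univ _) (hband j)) (hf's j)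
      (fun x _ => (hΦc.comp (continuous_snoc_right x)).continuousOn) (fun x hx t ht => ?_)
      (hf'i j) ((hsecsa _ (hhisa j)).sub_holds (hsecsa _ (hlosa j)))
      (integrableOn_of_bdd hC (hCb j) ((hsecsa _ (hhisa j)).sub_holds (hsecsa _ (hlosa j))) (M + M)
        fun x hx => (abs_sub _ _).trans (add_le_add (hM _ (hclI (hends j x hx).2.2))
          (hM _ (hclI (hends j x hx).2.1))))
    have hzW := hIooW j x hx t ht
    have h := hder (Fin.snoc x t) (by rw [hrd]; exact ⟨hzW, by simpa only [mem_setOf_eq, Fin.init_snoc] using hx⟩)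
    simp only [Fin.init_snoc, Fin.snoc_last] at h
    rwa [hf'W _ hzW]
  choose rb rd hrbd hrbi hrdd hrdi hNLrel using hNL
  have e2 : ∀ j : {j // j ∈ B}, KZ.of (Ob j) - KZ.of (rb j) ∈ KZ.relations := by
    intro j
    refine KZ.of_sub_of_mem_relations_of_null (Ob j) (rb j) ?_ ?_ fun z hz => ?_
    · rw [hObd, hrbd, show bandOver C ξ j \ KZlog.band C (lo j) (hi j) = ∅ from
        sdiff_eq_empty.mpr (hObsubband j), measure_empty]
    · rw [hrbd, hObd]; exact hnull j
    · rw [hObi, hrbi, hf'W z (hBsub j j.2 (by rw [← hObd j]; exact hz.1))]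
  -- Step 3: the section representations `[C, Φ(·, ξ_i)]` (when integrable) and the band telescoping
  set sec : Fin l → KZ.IntegralRep N := fun i =>
    if h : IntegrableOn (fun x => Φ (Fin.snoc x (ξ i x) : Fin (N + 1) → ℝ)) C volume then
      ⟨C, fun x => Φ (Fin.snoc x (ξ i x)), hC, hsecsa _ (hξ i), h⟩
    else ⟨C, fun _ => ((0 : ℚ) : ℝ), hC, isSemialgebraicFunOn_ratCast hC 0,
      by simp only [Rat.cast_zero]; exact integrableOn_zero⟩ with hsecdef
  have hsecd : ∀ i, (sec i).domain = C := by
    intro i; simp only [hsecdef]; split_ifs <;> rfl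
  have hseci : ∀ i, IntegrableOn (fun x => Φ (Fin.snoc x (ξ i x) : Fin (N + 1) → ℝ)) C volume →
      (sec i).integrand = fun x => Φ (Fin.snoc x (ξ i x)) := by
    intro i h; simp only [hsecdef, dif_pos h]
  have hint_hi : ∀ j : {j // j ∈ B},
      IntegrableOn (fun x => Φ (Fin.snoc x (hi j x) : Fin (N + 1) → ℝ)) C volume := fun j =>
    integrableOn_of_bdd hC (hCb j) (hsecsa _ (hhisa j)) M fun x hx => hM _ (hclI (hends j x hx).2.2)
  have hint_lo : ∀ j : {j // j ∈ B},
      IntegrableOn (fun x => Φ (Fin.snoc x (lo j x) : Fin (N + 1) → ℝ)) C volume := fun j =>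
    integrableOn_of_bdd hC (hCb j) (hsecsa _ (hlosa j)) M fun x hx => hM _ (hclI (hends j x hx).2.1)
  have htopi : ∀ j : {j // j ∈ B}, (sec ((j : Fin (l + 1)).castPred (hl j))).integrand =
      fun x => Φ (Fin.snoc x (hi j x)) := fun j => hseci _ (hint_hi j)
  have hboti : ∀ j : {j // j ∈ B}, (sec ((j : Fin (l + 1)).pred (h0 j))).integrand =
      fun x => Φ (Fin.snoc x (lo j x)) := fun j => hseci _ (hint_lo j)
  have e3 : ∀ j : {j // j ∈ B}, KZ.of (rd j) - (KZ.of (sec ((j : Fin (l + 1)).castPred (hl j))) -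
      KZ.of (sec ((j : Fin (l + 1)).pred (h0 j)))) ∈ KZ.relations := by
    intro j
    have hadd : KZ.of (rd j) - KZ.of (sec ((j : Fin (l + 1)).castPred (hl j))) -
        KZ.of (sec ((j : Fin (l + 1)).pred (h0 j))).neg ∈ KZ.relations := by
      refine KZ.integrandAddRel_subset_relations ⟨N, rd j, _, _, ?_, ?_, fun x hx => ?_, rfl⟩
      · rw [hsecd, hrdd]
      · rw [KZ.IntegralRep.domain_neg, hsecd, hrdd]
      · simp only [hrdi, Pi.add_apply, KZ.IntegralRep.integrand_neg, Pi.neg_apply, htopi, hboti]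
        ring
    have hneg : KZ.of (sec ((j : Fin (l + 1)).pred (h0 j))) +
        KZ.of (sec ((j : Fin (l + 1)).pred (h0 j))).neg ∈ KZ.relations :=
      KZ.of_add_of_mem_relations_of_eqOn_neg rfl fun x _ => rfl
    have : KZ.of (rd j) - (KZ.of (sec ((j : Fin (l + 1)).castPred (hl j))) -
        KZ.of (sec ((j : Fin (l + 1)).pred (h0 j)))) =
        (KZ.of (rd j) - KZ.of (sec ((j : Fin (l + 1)).castPred (hl j))) -
          KZ.of (sec ((j : Fin (l + 1)).pred (h0 j))).neg) +
        (KZ.of (sec ((j : Fin (l + 1)).pred (h0 j))) +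
          KZ.of (sec ((j : Fin (l + 1)).pred (h0 j))).neg) := by abel
    rw [this]
    exact KZ.relations.add_mem hadd hneg
  -- Step 4: telescoping — interior sections cancel
  set T : Finset (Fin l) := Finset.univ.filter fun i => i.castSucc ∈ B with hTdef
  set T' : Finset (Fin l) := Finset.univ.filter fun i => i.succ ∈ B with hT'def
  have hsumtop : ∑ j ∈ B.attach, KZ.of (sec ((j : Fin (l + 1)).castPred (hl j))) =
      ∑ i ∈ T, KZ.of (sec i) := by
    refine Finset.sum_bij' (fun j _ => (j : Fin (l + 1)).castPred (hl j))
      (fun i hi => ⟨i.castSucc, (Finset.mem_filter.1 hi).2⟩) (fun j _ => ?_) (fun i hi => ?_)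
      (fun j _ => ?_) (fun i hi => ?_) (fun j _ => rfl)
    · exact Finset.mem_filter.2 ⟨Finset.mem_univ _, by rw [Fin.castSucc_castPred]; exact j.2⟩
    · exact Finset.mem_attach _ _
    · exact Subtype.ext (Fin.castSucc_castPred (j : Fin (l + 1)) (hl j))
    · exact Fin.castPred_castSucc
  have hsumbot : ∑ j ∈ B.attach, KZ.of (sec ((j : Fin (l + 1)).pred (h0 j))) =
      ∑ i ∈ T', KZ.of (sec i) := by
    refine Finset.sum_bij' (fun j _ => (j : Fin (l + 1)).pred (h0 j))
      (fun i hi => ⟨i.succ, (Finset.mem_filter.1 hi).2⟩) (fun j _ => ?_) (fun i hi => ?_)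
      (fun j _ => ?_) (fun i hi => ?_) (fun j _ => rfl)
    · exact Finset.mem_filter.2 ⟨Finset.mem_univ _, by rw [Fin.succ_pred]; exact j.2⟩
    · exact Finset.mem_attach _ _
    · exact Subtype.ext (Fin.succ_pred (j : Fin (l + 1)) (h0 j))
    · exact Fin.pred_succ i
  have htel : ∑ j ∈ B.attach, (KZ.of (sec ((j : Fin (l + 1)).castPred (hl j))) -
      KZ.of (sec ((j : Fin (l + 1)).pred (h0 j)))) =
      ∑ i ∈ T \ T', KZ.of (sec i) - ∑ i ∈ T' \ T, KZ.of (sec i) := by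
    rw [Finset.sum_sub_distrib, hsumtop, hsumbot, Finset.sum_sdiff_sub_sum_sdiff]
  -- Step 5: the surviving sections have graph in `frontier W`
  have hfrontier : ∀ (i : Fin l) (x : Fin N → ℝ), x ∈ C →
      (Fin.snoc x (ξ i x) : Fin (N + 1) → ℝ) ∈ closure W → (i.succ ∈ B → i.castSucc ∈ B → False) →
      (Fin.snoc x (ξ i x) : Fin (N + 1) → ℝ) ∈ frontier W := by
    intro i x hx hcl hnot
    rw [hWo.frontier_eq]
    refine ⟨hcl, fun hW => ?_⟩
    have h := adjacent_mem_of_snoc_mem hWo ξ (hmono x hx) G B (hfib x hx) hW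
    exact hnot h.1 h.2
  have htop : ∀ i ∈ T \ T', InBaker (KZ.of (sec i)) := by
    intro i hi
    rw [Finset.mem_sdiff, Finset.mem_filter, Finset.mem_filter] at hi
    obtain ⟨⟨-, hiB⟩, hiB'⟩ := hi
    have hiB' : i.succ ∉ B := fun h => hiB' ⟨Finset.mem_univ _, h⟩
    set j : {j // j ∈ B} := ⟨i.castSucc, hiB⟩
    have hji : (j : Fin (l + 1)).castPred (hl j) = i := Fin.castPred_castSucc
    have hhi : hi j = ξ i := by simp only [hhidef, hji]
    have hint : IntegrableOn (fun x => Φ (Fin.snoc x (ξ i x) : Fin (N + 1) → ℝ)) C volume := by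
      have h := hint_hi j; rwa [hhi] at h
    refine hsec (ξ i) (hξ i) (hξc i) (fun x hx => hfrontier i x hx ?_ fun h _ => hiB' h) (sec i)
      (hsecd i) fun x _ => by rw [hseci i hint]
    rw [← hhi]; exact (hends j x hx).2.2
  have hbot : ∀ i ∈ T' \ T, InBaker (KZ.of (sec i)) := by
    intro i hi
    rw [Finset.mem_sdiff, Finset.mem_filter, Finset.mem_filter] at hi
    obtain ⟨⟨-, hiB⟩, hiB'⟩ := hi
    have hiB' : i.castSucc ∉ B := fun h => hiB' ⟨Finset.mem_univ _, h⟩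
    set j : {j // j ∈ B} := ⟨i.succ, hiB⟩
    have hji : (j : Fin (l + 1)).pred (h0 j) = i := Fin.pred_succ i
    have hlo : lo j = ξ i := by simp only [hlodef, hji]
    have hint : IntegrableOn (fun x => Φ (Fin.snoc x (ξ i x) : Fin (N + 1) → ℝ)) C volume := by
      have h := hint_lo j; rwa [hlo] at h
    refine hsec (ξ i) (hξ i) (hξc i) (fun x hx => hfrontier i x hx ?_ fun _ h => hiB' h) (sec i)
      (hsecd i) fun x _ => by rw [hseci i hint]
    rw [← hlo]; exact (hends j x hx).2.1
  -- assembly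
  have hX : InBaker (∑ i ∈ T \ T', KZ.of (sec i) - ∑ i ∈ T' \ T, KZ.of (sec i)) :=
    (InBaker.sum _ _ htop).sub (InBaker.sum _ _ hbot)
  refine hX.congr ?_
  have e2' : ∑ j ∈ B.attach, KZ.of (Ob j) - ∑ j ∈ B.attach, KZ.of (rb j) ∈ KZ.relations :=
    KZ.sum_sub_sum_mem_relations _ _ _ fun j _ => e2 j
  have eNL : ∑ j ∈ B.attach, KZ.of (rb j) - ∑ j ∈ B.attach, KZ.of (rd j) ∈ KZ.relations :=
    KZ.sum_sub_sum_mem_relations _ _ _ fun j _ => hNLrel j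
  have e3' : ∑ j ∈ B.attach, KZ.of (rd j) - ∑ j ∈ B.attach,
      (KZ.of (sec ((j : Fin (l + 1)).castPred (hl j))) - KZ.of (sec ((j : Fin (l + 1)).pred (h0 j)))) ∈
      KZ.relations :=
    KZ.sum_sub_sum_mem_relations _ _ _ fun j _ => e3 j
  rw [← htel]
  have : KZ.of r - ∑ j ∈ B.attach, (KZ.of (sec ((j : Fin (l + 1)).castPred (hl j))) -
      KZ.of (sec ((j : Fin (l + 1)).pred (h0 j)))) =
      (KZ.of r - ∑ j ∈ B.attach, KZ.of (Ob j)) +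
      (∑ j ∈ B.attach, KZ.of (Ob j) - ∑ j ∈ B.attach, KZ.of (rb j)) +
      (∑ j ∈ B.attach, KZ.of (rb j) - ∑ j ∈ B.attach, KZ.of (rd j)) +
      (∑ j ∈ B.attach, KZ.of (rd j) - ∑ j ∈ B.attach,
        (KZ.of (sec ((j : Fin (l + 1)).castPred (hl j))) - KZ.of (sec ((j : Fin (l + 1)).pred (h0 j))))) := by
    abel
  rw [this]
  exact KZ.relations.add_mem (KZ.relations.add_mem (KZ.relations.add_mem e1 e2') eNL) e3'

/-! #### 25.4 The engine: Newton–Leibniz over a planar base, modulo the Baker sector -/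

/-- **PLANAR SECTIONS ENGINE.**  Let `W ⊆ [0,1]^{N+1}` be OPEN and `ℚ`-semialgebraic, `Φ` a continuous
`ℚ`-semialgebraic function on `ℝ^{N+1}`, and `r = [W, f]` with `∂Φ/∂t (z) = f z` (derivative in the
last coordinate) at every `z ∈ W`.  Suppose every BOUNDARY SECTION TERM is in the Baker sector: for
every `ℚ`-semialgebraic `S ⊆ ℝ^N` and every continuous `ℚ`-semialgebraic `ζ : S → ℝ` whose graph lies
in `frontier W`, every representation `[S, x ↦ Φ(x, ζ x)]` is `InBaker`.  Then `[r] ∈ InBaker`: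
cut along the cylinders over a cylindrical decomposition of `ℝ^N` adapted to `W`
(`KZ.of_sub_sum_cyl_mem_relations`) and treat each cell by `InBaker.of_cadCell`.
[KontsevichZagier2001 §1.2 rules (1),(3); BasuPollackRoy2006 Cor. 5.7] -/
theorem InBaker.of_planar_sections {N : ℕ} {W : Set (Fin (N + 1) → ℝ)} (hWo : IsOpen W)
    (hWs : IsSemialgebraic ℚ W) (hWI : W ⊆ Icc 0 1) (Φ : (Fin (N + 1) → ℝ) → ℝ)
    (hΦs : IsSemialgebraicFunOn ℚ univ Φ) (hΦc : Continuous Φ) (r : KZ.IntegralRep (N + 1))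
    (hrW : r.domain = W)
    (hder : ∀ z ∈ W,
      HasDerivAt (fun s : ℝ => Φ (Fin.snoc (Fin.init z) s)) (r.integrand z) (z (Fin.last N)))
    (hsec : ∀ (S : Set (Fin N → ℝ)) (ζ : (Fin N → ℝ) → ℝ), IsSemialgebraic ℚ S →
      IsSemialgebraicFunOn ℚ S ζ → ContinuousOn ζ S →
      (∀ x ∈ S, (Fin.snoc x (ζ x) : Fin (N + 1) → ℝ) ∈ frontier W) →
      ∀ r₁ : KZ.IntegralRep N, r₁.domain = S →
        EqOn r₁.integrand (fun x => Φ (Fin.snoc x (ζ x))) S → InBaker (KZ.of r₁)) :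
    InBaker (KZ.of r) := by
  classical
  obtain ⟨𝒮, l, ξ, hcd, hcont, hξ, hmono, hcells, hfib⟩ :=
    IsSemialgebraic.exists_cylindricalDecomposition.exists_fibre_eq
      (IsSemialgebraic.exists_cylindricalDecomposition_holds (k := ℚ)) hWs
  have hpart := hcd.isPartition
  have h𝒮sa := hcd.isSemialgebraic
  let R : {C // C ∈ 𝒮} → KZ.IntegralRep (N + 1) := fun C =>
    r.restrict (r.domain ∩ {z | Fin.init z ∈ (C : Set (Fin N → ℝ))})
      (r.isSemialgebraic_domain.inter (h𝒮sa C C.2).setOf_init_mem) inter_subset_left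
  have eR : KZ.of r - ∑ C ∈ 𝒮.attach, KZ.of (R C) ∈ KZ.relations :=
    KZ.of_sub_sum_cyl_mem_relations r 𝒮 hpart R (fun C => rfl) fun C x _ => rfl
  have hcell : ∀ C : {C // C ∈ 𝒮}, InBaker (KZ.of (R C)) := by
    intro C
    obtain ⟨G, B, -, hBsub, hfibC⟩ := hfib C C.2
    exact InBaker.of_cadCell hWo hWs hWI Φ hΦs hΦc (h𝒮sa C C.2) (ξ C) (hξ C C.2) (hcont C C.2)
      (hmono C C.2) G B hBsub (hcells C C.2).2 hfibC (R C) (by rw [← hrW]; rfl)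
      (fun z hz => hder z (hrW ▸ hz.1)) fun ζ hζ hζc hfr r₁ hr₁ hr₁i =>
        hsec C ζ (h𝒮sa C C.2) hζ hζc hfr r₁ hr₁ hr₁i
  exact (InBaker.sum _ _ fun C _ => hcell C).congr eR

end Summit.KontsevichZagierPeriods.RootDecompWalshStrata.ConicDescent
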